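import Literature.NumberTheory.Automorphic.GL2ZFiniteOfEigenfunction
import Literature.NumberTheory.Automorphic.NewformAdelisationArchCovariance
import Literature.NumberTheory.Automorphic.CentralDerivativesTranslationGL
import Literature.NumberTheory.Automorphic.ArchimedeanCharacterTwist
import HarnessLib

/-!
# The `Z(𝔤)`-character of a `(C, Z)`-eigenfunction on `GL₂(𝔸_ℚ)` is determined by the
# eigenvalues; central words for `C` and `Z`; the reflection `ε` preserves the eigen-equations

Topic `NumberTheory/Automorphic`; theorems only (no definition, no named fact; D-0026). Complements
`GL2ZFiniteOfEigenfunction` (`Rat.hasZCharacter_of_casimir_of_zed`: a smooth `φ` on `GL₂(𝔸_ℚ)`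
with `C φ = (s₁² + s₂² - ½) φ`, `Z φ = (s₁ + s₂) φ` along `ι_𝔸` has a `Z(𝔤)`-character) toward the
archimedean parameter of the automorphic representation of a holomorphic newform:

* `Rat.exists_scalar_applyFree_of_casimir_of_zed` — **every central word acts on all such `φ` by
  one and the same scalar** `A(p) = γ(p)(s₁, s₂)` (`Z(U(𝔤𝔩₂)) = ℂ[Z, C]`,
  `GL2Casimir.lift_center_apply_eq_smul_of_casimir_of_zed`);
* `Rat.hasZCharacter_of_hasZCharacter_of_casimir_of_zed` — hence two non-zero such functions have
  the same `Z(𝔤)`-character;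
* `Rat.exists_isCentralWord_applyFree_eq_sum_lieDeriv_single` /
  `Rat.exists_isCentralWord_applyFree_eq_lieDeriv_one` — central words acting as `C` and `Z` along
  `ι_𝔸`; `Rat.sum_lieDeriv_single_eq_smul_of_hasZCharacter` /
  `Rat.lieDeriv_one_eq_smul_of_hasZCharacter` — a function with the `Z(𝔤)`-character of a
  `(C, Z)`-eigenfunction `φ ≠ 0` satisfies the same eigen-equations;
* `Rat.sum_lieDeriv_single_archTranslate_epsK` / `Rat.lieDeriv_one_archTranslate_epsK` —
  `r(ε)`, `ε = diag(1, -1)`, preserves the eigen-equations (`Ad ε` fixes `E₁₁, E₂₂` and negates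
  `E₁₂, E₂₁`, `archTranslate_lieDeriv`).

## References

* A. Borel, H. Jacquet, Corvallis 1979, §1.6, 4.2–4.3. [BorelJacquet1979]
* A. W. Knapp, *Lie Groups Beyond an Introduction* (2002), Thm. 5.44. [Knapp2002]
* D. Bump, *Automorphic Forms and Representations* (1997), §2.2. [Bump1997]
-/

noncomputable section

open scoped MatrixGroups Matrix Classical
open NumberField NumberField.mixedEmbedding UniversalEnvelopingAlgebra

namespace Literature.NumberTheory.Automorphic

-- Mathlib idiom (Mathlib/Algebra/Lie/OfAssociative.lean), as in `GL2WeightVectors`: Lie subalgebras of matrix algebras.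
attribute [local instance 100] LieRing.ofAssociativeRing

open GL2Real GLnCasimir

variable {hcpt : isCompact_glFiniteIntegralLevel 2 ℚ}

/-! ### Central words act on `(C, Z)`-eigenfunctions by universal scalars -/

set_option maxHeartbeats 800000 in
/-- **Central words act on `(C, Z)`-eigenfunctions by universal scalars.** For every central word
`p` of `ℝ⟨𝔤⟩`, `𝔤 = 𝔤𝔩₂(ℚ_∞)`, there is `A ∈ ℂ` such that `p φ = A φ` for EVERY smooth `φ` on
`GL₂(𝔸_ℚ)` with `C φ = (s₁² + s₂² - ½) φ` and `Z φ = (s₁ + s₂) φ` along `ι_𝔸` (namely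
`A = γ(ũ)(s₁, s₂)` for the transport `ũ ∈ Z(U(𝔤𝔩₂(ℝ)))` of the class of `p`; the proof of
`Rat.hasZCharacter_of_casimir_of_zed` with the explicit scalar of
`GL2Casimir.lift_center_apply_eq_smul_of_casimir_of_zed`). [cite: Knapp2002, Thm. 5.44] [cite: BorelJacquet1979, §1.6] -/
theorem Rat.exists_scalar_applyFree_of_casimir_of_zed (s₁ s₂ : ℂ)
    (p : FreeAlgebra ℝ (AutomorphyDatum.gl 2 ℚ hcpt).arch.lie) (hp : IsCentralWord p) :
    ∃ A : ℂ, ∀ (φ : (AdelicGroupData.gl 2 ℚ).Adelic → ℂ),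
      IsArchSmooth (AutomorphyDatum.gl 2 ℚ hcpt).ofArch φ →
      (∑ a : Fin 2, ∑ b : Fin 2, lieDeriv Rat.iotaA (toLie (Matrix.single a b (1 : ℝ)))
          (lieDeriv Rat.iotaA (toLie (Matrix.single b a (1 : ℝ))) φ)) = (s₁ ^ 2 + s₂ ^ 2 - 1 / 2) • φ →
      lieDeriv Rat.iotaA (toLie 1) φ = (s₁ + s₂) • φ →
      applyFree (AutomorphyDatum.gl 2 ℚ hcpt).ofArch p φ = A • φ := by
  classical
  have hH : (AutomorphyDatum.gl 2 ℚ hcpt).arch.lie = ⊤ := archGroupGL_lie 2 ℚ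
  have hc : (AutomorphyDatum.gl 2 ℚ hcpt).arch.carrier = ⊤ := archGroupGL_carrier 2 ℚ
  obtain ⟨e, he⟩ := Rat.exists_lieEquiv_lieOfReal hcpt
  set ρt := lieDerivRep (AutomorphyDatum.gl 2 ℚ hcpt).ofArch hH hc with hρt
  set ρM : Matrix (Fin 2) (Fin 2) ℝ →ₗ⁅ℝ⁆ Module.End ℂ (archSmooth (AutomorphyDatum.gl 2 ℚ hcpt).ofArch) :=
    ρt.comp e.toLieHom with hρM
  let m : UniversalEnvelopingAlgebra ℝ (AutomorphyDatum.gl 2 ℚ hcpt).arch.lie →ₐ[ℝ]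
      UniversalEnvelopingAlgebra ℝ (Matrix (Fin 2) (Fin 2) ℝ) :=
    lift ℝ ((UniversalEnvelopingAlgebra.ι ℝ).comp e.symm.toLieHom)
  set u : UniversalEnvelopingAlgebra ℝ (AutomorphyDatum.gl 2 ℚ hcpt).arch.lie :=
    freeToEnveloping (AutomorphyDatum.gl 2 ℚ hcpt).arch p with hu
  have hmu : m u ∈ Subalgebra.center ℝ (UniversalEnvelopingAlgebra ℝ (Matrix (Fin 2) (Fin 2) ℝ)) :=
    UEnv.map_symm_mem_center e hp
  refine ⟨MvPolynomial.aeval (fun q : (ℝ →ₐ[ℝ] ℂ) × Fin 2 => (![s₁, s₂] : Fin 2 → ℂ) q.2)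
      ((harishChandraHomGL ℝ 2).toAlgHom ⟨m u, hmu⟩), fun φ hφ hC hZ => ?_⟩
  set v : archSmooth (AutomorphyDatum.gl 2 ℚ hcpt).ofArch := ⟨φ, hφ⟩ with hv
  have hρM_coe : ∀ (X : Matrix (Fin 2) (Fin 2) ℝ) (ψ : archSmooth (AutomorphyDatum.gl 2 ℚ hcpt).ofArch),
      ((ρM X ψ : archSmooth (AutomorphyDatum.gl 2 ℚ hcpt).ofArch) : (AdelicGroupData.gl 2 ℚ).Adelic → ℂ) =
        lieDeriv Rat.iotaA (toLie X) ψ := by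
    intro X ψ
    change ((ρt (e X) ψ : archSmooth (AutomorphyDatum.gl 2 ℚ hcpt).ofArch) : (AdelicGroupData.gl 2 ℚ).Adelic → ℂ) = _
    rw [hρt, lieDerivRep_apply_coe, he, Rat.lieDeriv_ofArch_lieOfReal_eq]
  have hCM : lift ℝ ρM (casimir 2) v = (s₁ ^ 2 + s₂ ^ 2 - 1 / 2) • v := by
    apply Subtype.ext
    rw [casimir_eq_sum]
    simp only [map_sum, LinearMap.sum_apply, GL2Casimir.lift_ιU_mul_ιU_apply]
    rw [Submodule.coe_sum]
    simp only [Submodule.coe_sum, hρM_coe, Submodule.coe_smul]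
    exact hC
  have hZM : lift ℝ ρM (zed 2) v = (s₁ + s₂) • v := by
    have h1 : lift ℝ ρM (zed 2) v = ρM 1 v := by
      change lift ℝ ρM (UniversalEnvelopingAlgebra.ι ℝ (1 : Matrix (Fin 2) (Fin 2) ℝ)) v = _
      rw [lift_ι_apply]
    rw [h1]
    apply Subtype.ext
    rw [hρM_coe, Submodule.coe_smul]
    exact hZ
  have h1 : applyFree (AutomorphyDatum.gl 2 ℚ hcpt).ofArch p φ =
      ((envelopingAction ρt u v : archSmooth _) : (AdelicGroupData.gl 2 ℚ).Adelic → ℂ) :=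
    (coe_envelopingAction_freeToEnveloping hH hc p v).symm
  have h2 : envelopingAction ρt u = lift ℝ ρM (m u) := by
    have hnat := UEnv.lift_comp_map e.toLieHom ρt
    have h3 : lift ℝ ρt u = lift ℝ ρt (lift ℝ ((UniversalEnvelopingAlgebra.ι ℝ).comp e.toLieHom) (m u)) := by
      rw [UEnv.map_map_symm e u]
    change lift ℝ ρt u = _
    rw [h3, ← AlgHom.comp_apply, hnat]
  have h4 : lift ℝ ρM (m u) v = (MvPolynomial.aeval (fun q : (ℝ →ₐ[ℝ] ℂ) × Fin 2 => (![s₁, s₂] : Fin 2 → ℂ) q.2)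
      ((harishChandraHomGL ℝ 2).toAlgHom ⟨m u, hmu⟩)) • v :=
    GL2Casimir.lift_center_apply_eq_smul_of_casimir_of_zed ρM hCM hZM ⟨m u, hmu⟩
  rw [h1, h2, h4, Submodule.coe_smul]

/-- **Two non-zero `(C, Z)`-eigenfunctions with the same eigenvalues have the same
`Z(𝔤)`-character**: if `φ ≠ 0` has `Z(𝔤)`-character `θ` and `φ'` has `Z(𝔤)`-character `θ'`, both
smooth with `C = s₁² + s₂² - ½`, `Z = s₁ + s₂`, then `φ'` has `Z(𝔤)`-character `θ`.
[cite: BorelJacquet1979, §1.6] [cite: Knapp2002, Thm. 5.44] -/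
theorem Rat.hasZCharacter_of_hasZCharacter_of_casimir_of_zed {s₁ s₂ : ℂ}
    {φ φ' : (AdelicGroupData.gl 2 ℚ).Adelic → ℂ}
    (hφ : IsArchSmooth (AutomorphyDatum.gl 2 ℚ hcpt).ofArch φ) (hφ0 : φ ≠ 0)
    (hC : (∑ a : Fin 2, ∑ b : Fin 2, lieDeriv Rat.iotaA (toLie (Matrix.single a b (1 : ℝ)))
        (lieDeriv Rat.iotaA (toLie (Matrix.single b a (1 : ℝ))) φ)) = (s₁ ^ 2 + s₂ ^ 2 - 1 / 2) • φ)
    (hZ : lieDeriv Rat.iotaA (toLie 1) φ = (s₁ + s₂) • φ)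
    {θ : centerU (AutomorphyDatum.gl 2 ℚ hcpt).arch →ₐ[ℝ] ℂ}
    (hθ : HasZCharacter (AutomorphyDatum.gl 2 ℚ hcpt).ofArch φ θ)
    (hφ' : IsArchSmooth (AutomorphyDatum.gl 2 ℚ hcpt).ofArch φ')
    (hC' : (∑ a : Fin 2, ∑ b : Fin 2, lieDeriv Rat.iotaA (toLie (Matrix.single a b (1 : ℝ)))
        (lieDeriv Rat.iotaA (toLie (Matrix.single b a (1 : ℝ))) φ')) = (s₁ ^ 2 + s₂ ^ 2 - 1 / 2) • φ')
    (hZ' : lieDeriv Rat.iotaA (toLie 1) φ' = (s₁ + s₂) • φ') :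
    HasZCharacter (AutomorphyDatum.gl 2 ℚ hcpt).ofArch φ' θ := by
  intro p hp
  obtain ⟨A, hA⟩ := Rat.exists_scalar_applyFree_of_casimir_of_zed (hcpt := hcpt) s₁ s₂ p hp
  have h1 := hA φ hφ hC hZ
  rw [hθ p hp] at h1
  have h2 : θ ⟨freeToEnveloping _ p, hp⟩ = A := smul_left_injective ℂ hφ0 h1
  rw [hA φ' hφ' hC' hZ', ← h2]

/-! ### Central words for `C` and `Z` -/

/-- **A central word acting as the Casimir operator `C = ∑ E_{ab}E_{ba}` along `ι_𝔸`**: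
`p_C = ∑ (E_{ab} ⊗ 1)(E_{ba} ⊗ 1)`, whose class in `U(𝔤)` is the transport of the Casimir
element of `U(𝔤𝔩₂(ℝ))` (central, `GLnCasimir.casimir_mem_center`). [cite: BorelJacquet1979, §1.6] [cite: Bump1997, §2.2] -/
theorem Rat.exists_isCentralWord_applyFree_eq_sum_lieDeriv_single :
    ∃ p : FreeAlgebra ℝ (AutomorphyDatum.gl 2 ℚ hcpt).arch.lie, IsCentralWord p ∧
      ∀ ψ : (AdelicGroupData.gl 2 ℚ).Adelic → ℂ,
        applyFree (AutomorphyDatum.gl 2 ℚ hcpt).ofArch p ψ =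
          ∑ a : Fin 2, ∑ b : Fin 2, lieDeriv Rat.iotaA (toLie (Matrix.single a b (1 : ℝ)))
            (lieDeriv Rat.iotaA (toLie (Matrix.single b a (1 : ℝ))) ψ) := by
  classical
  obtain ⟨e, he⟩ := Rat.exists_lieEquiv_lieOfReal hcpt
  refine ⟨∑ a : Fin 2, ∑ b : Fin 2, FreeAlgebra.ι ℝ (Rat.lieOfReal hcpt (Matrix.single a b (1 : ℝ))) *
      FreeAlgebra.ι ℝ (Rat.lieOfReal hcpt (Matrix.single b a (1 : ℝ))), ?_, fun ψ => ?_⟩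
  · -- centrality: the class is `U(e) (casimir 2)`
    have hclass : freeToEnveloping (AutomorphyDatum.gl 2 ℚ hcpt).arch
        (∑ a : Fin 2, ∑ b : Fin 2, FreeAlgebra.ι ℝ (Rat.lieOfReal hcpt (Matrix.single a b (1 : ℝ))) *
          FreeAlgebra.ι ℝ (Rat.lieOfReal hcpt (Matrix.single b a (1 : ℝ)))) =
        lift ℝ ((UniversalEnvelopingAlgebra.ι ℝ).comp e.toLieHom) (casimir 2) := by
      rw [casimir_eq_sum]
      simp only [map_sum, map_mul, freeToEnveloping_ι]
      refine Finset.sum_congr rfl fun a _ => Finset.sum_congr rfl fun b _ => ?_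
      change _ = lift ℝ ((UniversalEnvelopingAlgebra.ι ℝ).comp e.toLieHom) (UniversalEnvelopingAlgebra.ι ℝ _) *
        lift ℝ ((UniversalEnvelopingAlgebra.ι ℝ).comp e.toLieHom) (UniversalEnvelopingAlgebra.ι ℝ _)
      rw [lift_ι_apply, lift_ι_apply, LieHom.comp_apply, LieHom.comp_apply, LieEquiv.coe_toLieHom, he, he]
    change freeToEnveloping _ _ ∈ centerU _
    rw [hclass]
    have h := UEnv.map_symm_mem_center e.symm (casimir_mem_center 2)
    rwa [LieEquiv.symm_symm] at h
  · rw [applyFree_finset_sum]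
    refine Finset.sum_congr rfl fun a _ => ?_
    rw [applyFree_finset_sum]
    refine Finset.sum_congr rfl fun b _ => ?_
    rw [applyFree_mul_ι, applyFree_ι_eq_lieDeriv, Rat.lieDeriv_ofArch_lieOfReal_eq, Rat.lieDeriv_ofArch_lieOfReal_eq]

/-- **A central word acting as `Z = 1` along `ι_𝔸`**: the letter `1 ⊗ 1`. [cite: BorelJacquet1979, §1.6] -/
theorem Rat.exists_isCentralWord_applyFree_eq_lieDeriv_one :
    ∃ p : FreeAlgebra ℝ (AutomorphyDatum.gl 2 ℚ hcpt).arch.lie, IsCentralWord p ∧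
      ∀ ψ : (AdelicGroupData.gl 2 ℚ).Adelic → ℂ,
        applyFree (AutomorphyDatum.gl 2 ℚ hcpt).ofArch p ψ = lieDeriv Rat.iotaA (toLie 1) ψ := by
  obtain ⟨e, he⟩ := Rat.exists_lieEquiv_lieOfReal hcpt
  refine ⟨FreeAlgebra.ι ℝ (Rat.lieOfReal hcpt 1), ?_, fun ψ => ?_⟩
  · have hclass : freeToEnveloping (AutomorphyDatum.gl 2 ℚ hcpt).arch (FreeAlgebra.ι ℝ (Rat.lieOfReal hcpt 1)) =
        lift ℝ ((UniversalEnvelopingAlgebra.ι ℝ).comp e.toLieHom) (zed 2) := by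
      rw [freeToEnveloping_ι]
      change _ = lift ℝ ((UniversalEnvelopingAlgebra.ι ℝ).comp e.toLieHom) (UniversalEnvelopingAlgebra.ι ℝ 1)
      rw [lift_ι_apply, LieHom.comp_apply, LieEquiv.coe_toLieHom, he]
    change freeToEnveloping _ _ ∈ centerU _
    rw [hclass]
    have h := UEnv.map_symm_mem_center e.symm (zed_mem_center 2)
    rwa [LieEquiv.symm_symm] at h
  · rw [applyFree_ι_eq_lieDeriv, Rat.lieDeriv_ofArch_lieOfReal_eq]

/-- **A function with the `Z(𝔤)`-character of a `(C, Z)`-eigenfunction is a `C`-eigenfunction with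
the same eigenvalue**: if `φ ≠ 0` with `C φ = c φ` and `ψ` have the same `Z(𝔤)`-character `θ`, then
`C ψ = c ψ` (`C = p_C`, `θ(p_C) = c`). [cite: BorelJacquet1979, §1.6] -/
theorem Rat.sum_lieDeriv_single_eq_smul_of_hasZCharacter {c : ℂ}
    {φ ψ : (AdelicGroupData.gl 2 ℚ).Adelic → ℂ} (hφ0 : φ ≠ 0)
    (hC : (∑ a : Fin 2, ∑ b : Fin 2, lieDeriv Rat.iotaA (toLie (Matrix.single a b (1 : ℝ)))
        (lieDeriv Rat.iotaA (toLie (Matrix.single b a (1 : ℝ))) φ)) = c • φ)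
    {θ : centerU (AutomorphyDatum.gl 2 ℚ hcpt).arch →ₐ[ℝ] ℂ}
    (hθφ : HasZCharacter (AutomorphyDatum.gl 2 ℚ hcpt).ofArch φ θ)
    (hθψ : HasZCharacter (AutomorphyDatum.gl 2 ℚ hcpt).ofArch ψ θ) :
    (∑ a : Fin 2, ∑ b : Fin 2, lieDeriv Rat.iotaA (toLie (Matrix.single a b (1 : ℝ)))
        (lieDeriv Rat.iotaA (toLie (Matrix.single b a (1 : ℝ))) ψ)) = c • ψ := by
  obtain ⟨p, hp, hpC⟩ := Rat.exists_isCentralWord_applyFree_eq_sum_lieDeriv_single (hcpt := hcpt)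
  have h1 := hθφ p hp
  rw [hpC φ, hC] at h1
  have h2 : c = θ ⟨freeToEnveloping _ p, hp⟩ := smul_left_injective ℂ hφ0 h1
  rw [← hpC ψ, hθψ p hp, ← h2]

/-- Same for `Z`: `Z ψ = z ψ` if `Z φ = z φ`, `φ ≠ 0`, and `ψ`, `φ` share a `Z(𝔤)`-character. [cite: BorelJacquet1979, §1.6] -/
theorem Rat.lieDeriv_one_eq_smul_of_hasZCharacter {z : ℂ}
    {φ ψ : (AdelicGroupData.gl 2 ℚ).Adelic → ℂ} (hφ0 : φ ≠ 0)
    (hZ : lieDeriv Rat.iotaA (toLie 1) φ = z • φ)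
    {θ : centerU (AutomorphyDatum.gl 2 ℚ hcpt).arch →ₐ[ℝ] ℂ}
    (hθφ : HasZCharacter (AutomorphyDatum.gl 2 ℚ hcpt).ofArch φ θ)
    (hθψ : HasZCharacter (AutomorphyDatum.gl 2 ℚ hcpt).ofArch ψ θ) :
    lieDeriv Rat.iotaA (toLie 1) ψ = z • ψ := by
  obtain ⟨p, hp, hpZ⟩ := Rat.exists_isCentralWord_applyFree_eq_lieDeriv_one (hcpt := hcpt)
  have h1 := hθφ p hp
  rw [hpZ φ, hZ] at h1
  have h2 : z = θ ⟨freeToEnveloping _ p, hp⟩ := smul_left_injective ℂ hφ0 h1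
  rw [← hpZ ψ, hθψ p hp, ← h2]

/-! ### The reflection `ε` preserves the eigen-equations -/

/-- `Ad(ε) E_{ab} = σ_a σ_b E_{ab}` with `σ = (1, -1)`: `ε = diag(1, -1)` fixes `E₁₁, E₂₂` and
negates `E₁₂, E₂₁`. [folklore] -/
theorem GL2Real.Ad_epsK_single (a b : Fin 2) :
    (RealMatrixGroup.gl ℝ (Fin 2)).Ad epsK (toLie (Matrix.single a b (1 : ℝ))) =
      ((![1, -1] : Fin 2 → ℝ) a * (![1, -1] : Fin 2 → ℝ) b) • toLie (Matrix.single a b (1 : ℝ)) := by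
  refine Subtype.ext ?_
  change ((epsGL : GL (Fin 2) ℝ) : Matrix (Fin 2) (Fin 2) ℝ) * Matrix.single a b (1 : ℝ) *
      (((epsGL)⁻¹ : GL (Fin 2) ℝ) : Matrix (Fin 2) (Fin 2) ℝ) =
    ((![1, -1] : Fin 2 → ℝ) a * (![1, -1] : Fin 2 → ℝ) b) • Matrix.single a b (1 : ℝ)
  rw [epsGL_inv, coe_epsGL]
  ext i j
  simp only [Matrix.mul_apply, Fin.sum_univ_two, Matrix.smul_apply, Matrix.single_apply, smul_eq_mul]
  fin_cases a <;> fin_cases b <;> fin_cases i <;> fin_cases j <;> simp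

/-- `(-X) φ = -(X φ)` (no smoothness: `t ↦ φ(g exp(t(-X))) = φ(g exp((-t)X))`, `deriv_comp_neg`). [folklore] -/
theorem lieDeriv_neg_left {A : Type*} [NormedCommRing A] [NormedAlgebra ℝ A] [NormedAlgebra ℚ A] [CompleteSpace A]
    [StarRing A] {N : Type*} [Fintype N] [DecidableEq N] {H : RealMatrixGroup A N}
    {G : Type*} [Group G] (ι : H.carrier →* G) (X : H.lie) (φ : G → ℂ) :
    lieDeriv ι (-X) φ = -lieDeriv ι X φ := by
  funext g
  rw [Pi.neg_apply]
  unfold lieDeriv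
  set F : ℝ → ℂ := fun s => φ (g * ι (H.expMem (s • X))) with hF
  have e : (fun t : ℝ => φ (g * ι (H.expMem (t • -X)))) = fun t => F (-t) := by
    funext t
    simp only [hF, smul_neg, neg_smul]
  rw [e, deriv_comp_neg F, neg_zero]

/-- `X (-φ) = -(X φ)`. [folklore] -/
theorem lieDeriv_neg_right {A : Type*} [NormedCommRing A] [NormedAlgebra ℝ A] [NormedAlgebra ℚ A] [CompleteSpace A]
    [StarRing A] {N : Type*} [Fintype N] [DecidableEq N] {H : RealMatrixGroup A N}
    {G : Type*} [Group G] (ι : H.carrier →* G) (X : H.lie) (φ : G → ℂ) :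
    lieDeriv ι X (-φ) = -lieDeriv ι X φ := by
  rw [← neg_one_smul ℂ φ, lieDeriv_smul, neg_one_smul]

/-- **`r(ε)` preserves the Casimir eigen-equation**: if `C φ = c φ` along `ι_𝔸` then
`C (r(ε) φ) = c · r(ε) φ`, `r(ε) φ = archTranslate ι_𝔸 ε φ` (`archTranslate_lieDeriv` and
`Ad(ε) E_{ab} = ± E_{ab}` with the same sign for `E_{ab}` and `E_{ba}`). [cite: BorelJacquet1979, 4.3 (ii)] [cite: Bump1997, §2.2] -/
theorem Rat.sum_lieDeriv_single_archTranslate_epsK {c : ℂ} {φ : (AdelicGroupData.gl 2 ℚ).Adelic → ℂ}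
    (hC : (∑ a : Fin 2, ∑ b : Fin 2, lieDeriv Rat.iotaA (toLie (Matrix.single a b (1 : ℝ)))
        (lieDeriv Rat.iotaA (toLie (Matrix.single b a (1 : ℝ))) φ)) = c • φ) :
    (∑ a : Fin 2, ∑ b : Fin 2, lieDeriv Rat.iotaA (toLie (Matrix.single a b (1 : ℝ)))
        (lieDeriv Rat.iotaA (toLie (Matrix.single b a (1 : ℝ))) (archTranslate Rat.iotaA epsK φ))) =
      c • archTranslate Rat.iotaA epsK φ := by
  have h := congrArg (archTranslate Rat.iotaA epsK) hC
  rw [map_smul] at h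
  rw [← h, map_sum]
  simp only [map_sum, archTranslate_lieDeriv, GL2Real.Ad_epsK_single]
  refine Finset.sum_congr rfl fun a _ => Finset.sum_congr rfl fun b _ => ?_
  fin_cases a <;> fin_cases b <;>
    simp only [Fin.zero_eta, Fin.isValue, Fin.mk_one, Matrix.cons_val_zero, Matrix.cons_val_one,
      Matrix.cons_val_fin_one, mul_one, mul_neg, neg_neg, one_smul, neg_smul, lieDeriv_neg_left,
      lieDeriv_neg_right]

/-- **`r(ε)` preserves the `Z`-eigen-equation** (`Ad(ε) 1 = 1`). [cite: BorelJacquet1979, 4.3 (ii)] -/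
theorem Rat.lieDeriv_one_archTranslate_epsK {z : ℂ} {φ : (AdelicGroupData.gl 2 ℚ).Adelic → ℂ}
    (hZ : lieDeriv Rat.iotaA (toLie 1) φ = z • φ) :
    lieDeriv Rat.iotaA (toLie 1) (archTranslate Rat.iotaA epsK φ) = z • archTranslate Rat.iotaA epsK φ := by
  have h := congrArg (archTranslate Rat.iotaA epsK) hZ
  rw [map_smul, archTranslate_lieDeriv] at h
  have h1 : (RealMatrixGroup.gl ℝ (Fin 2)).Ad epsK (toLie 1) = toLie 1 := by
    refine Subtype.ext ?_
    change ((epsGL : GL (Fin 2) ℝ) : Matrix (Fin 2) (Fin 2) ℝ) * (1 : Matrix (Fin 2) (Fin 2) ℝ) *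
        (((epsGL)⁻¹ : GL (Fin 2) ℝ) : Matrix (Fin 2) (Fin 2) ℝ) = 1
    rw [Matrix.mul_one, ← Units.val_mul, mul_inv_cancel, Units.val_one]
  rw [h1] at h
  exact h

end Literature.NumberTheory.Automorphic
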